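import Summits.Ventures.CertifiedManyBodySolver.Downfold.EmeryFermiNodalVelocity
import Summits.Ventures.CertifiedManyBodySolver.Downfold.OneBandInPlaneFormDefect
import HarnessLib

/-!
# The ANTINODAL (zone-face) VELOCITY of the σ three-band (Emery) model, exactly: the squared k-gradient of the
# energy-linearised band at the zone-face Fermi point `(kx, ky) = (π, k_a)` in closed form, and a kd-checkable window

Venture CertifiedManyBodySolver, cell `pub/hubbard-downfold` (stage S1, technique B), seat hubbard-downfold-mod-4; namespace
`Summit.Ventures.CertifiedManyBodySolver.Downfold.Emery`. Everything PROVED; no number lives here. WHAT THIS IS NOT: a statement about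
any material; `U = 0` band kinematics; velocities are those of the ENERGY-LINEARISED band (as in `EmeryFermiNodalVelocity`), units `eV·a/ħ`.

Companion of `EmeryFermiNodalVelocity` (the node) for the 3→1-B comparison with the DIRECT one-band band at the ANTINODE
(`OneBandInPlaneFermiPoints.ipFace_of_checks`): in `x = sin²(kx/2) = 1` (zone face `kx = π`), `y = sin²(ky/2)`,

* §1 `∂charCubic/∂y = −(4fsD + 16fsN·x)` (`hasDerivAt_charCubic_y`, chain rule `hasDerivAt_charCubic_ky`); the `kx`-component of the
  gradient vanishes on the face (`sin(π/2)cos(π/2) = 0`); hence the squared face velocity of the linearised band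
  `faceVel2 = (4fsD + 16fsN)²·y(1 − y)/(∂_ε charCubic(1, y))²` (`faceVel2`); the face point solves the LINEAR equation
  `y·(4fsD + 16fsN) = cA − 4fsD` (`face_contour_eq`).
* §2 `ArithExpr` mirrors of `cA, fsD, fsN, dcA, dfsD` in the variables `x 0 = ε`, `x 1 = y` at a rational one-body point
  `(Δ_pd, t_pd, t_pp, t_pp′)`, and `faceCheck` = six kd claims (tree verifier `BoxCover`): face-point bracket `[y₁, y₂]`,
  positive energy denominator, window `[lo, hi] ∋ faceVel2`; soundness `faceVel2_mem_of_faceCheck`; composed with the point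
  Fermi-energy bracket of `EmeryFermiScalePoint`: `pointFace_of_checks`.

Sources: [HybertsenSchluterChristensen1989, Eq. (1)]; energy-linearised downfolding [AndersenEtAl1995, §6]; interval verification
[Moore1966, Theorem 3.1, §4.4].
-/

noncomputable section

namespace Summit.Ventures.CertifiedManyBodySolver.Downfold.Emery

open Real Set Literature.Analysis.ValidatedNumerics

/-! ## §1 Face geometry of the secular cubic -/

/-- `∂charCubic/∂y = −(4fsD + 16fsN·x)`. [folklore] -/
theorem hasDerivAt_charCubic_y (Δ tpd tpp c x ε y : ℝ) :
    HasDerivAt (fun y' => charCubic Δ tpd tpp c x y' ε) (-(4 * fsD Δ tpd c ε + 16 * fsN tpd tpp c ε * x)) y := by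
  have h : (fun y' => charCubic Δ tpd tpp c x y' ε) =
      fun y' => (cA Δ ε - 4 * fsD Δ tpd c ε * x) + (-(4 * fsD Δ tpd c ε + 16 * fsN tpd tpp c ε * x)) * y' := by
    funext y'; rw [charCubic_bilinear]; ring
  rw [h]
  have := ((hasDerivAt_id' y).const_mul (-(4 * fsD Δ tpd c ε + 16 * fsN tpd tpp c ε * x))).const_add
    (cA Δ ε - 4 * fsD Δ tpd c ε * x)
  exact this.congr_deriv (by ring)

/-- CHAIN RULE along `k_y` at fixed `k_x`: the `k_y`-derivative of the secular cubic at `(sin²(kx/2), sin²(ky/2))` is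
`−(4fsD + 16fsN·x)·sin(ky/2)cos(ky/2)`. [folklore] -/
theorem hasDerivAt_charCubic_ky (Δ tpd tpp c kx ε ky : ℝ) :
    HasDerivAt (fun k => charCubic Δ tpd tpp c (Real.sin (kx / 2) ^ 2) (Real.sin (k / 2) ^ 2) ε)
      (-(4 * fsD Δ tpd c ε + 16 * fsN tpd tpp c ε * Real.sin (kx / 2) ^ 2) * (Real.sin (ky / 2) * Real.cos (ky / 2))) ky := by
  have := (hasDerivAt_charCubic_y Δ tpd tpp c (Real.sin (kx / 2) ^ 2) ε (Real.sin (ky / 2) ^ 2)).comp ky (hasDerivAt_halfSq' ky)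
  simpa [Function.comp_def] using this

/-- On the zone face `kx = π` the `kx`-component of every chain-rule gradient vanishes: `sin(π/2)cos(π/2) = 0`, and `sin²(π/2) = 1`.
[folklore] -/
theorem face_kx_factor : Real.sin (π / 2) * Real.cos (π / 2) = 0 ∧ Real.sin (π / 2) ^ 2 = 1 := by
  simp [Real.cos_pi_div_two, Real.sin_pi_div_two]

/-- **Squared face velocity of the energy-linearised band** at the zone-face point `(x, y) = (1, y)` of the `ε`-contour (units
`(eV·a/ħ)²`): `|∇_k ε_lin|² = (∂_ky charCubic)²/(∂_ε charCubic)² = (4fsD + 16fsN)²·y(1 − y)/(∂_ε charCubic(1, y))²` — the single surviving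
Cartesian component by `hasDerivAt_charCubic_ky`, `face_kx_factor` and `sin_half_mul_cos_half_sq`. [cite: AndersenEtAl1995, §6] -/
def faceVel2 (Δ tpd tpp c y ε : ℝ) : ℝ :=
  (4 * fsD Δ tpd c ε + 16 * fsN tpd tpp c ε) ^ 2 * (y * (1 - y)) / dcharCubic Δ tpd tpp c 1 y ε ^ 2

/-- The face point of the contour solves a LINEAR equation: `charCubic(1, y, ε) = 0 ⇒ y·(4fsD + 16fsN) = cA − 4fsD`. [folklore] -/
theorem face_contour_eq {Δ tpd tpp c y ε : ℝ} (hP : charCubic Δ tpd tpp c 1 y ε = 0) :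
    y * (4 * fsD Δ tpd c ε + 16 * fsN tpd tpp c ε) = cA Δ ε - 4 * fsD Δ tpd c ε := by
  rw [charCubic_bilinear] at hP
  linarith

/-! ## §2 `ArithExpr` mirrors (variables `x 0 = ε`, `x 1 = y`) and the face check -/

/-- `cA = ε(Δ + ε)²`. [folklore] -/
def cAE (Δ : ℚ) : ArithExpr := .mul (.var 0) (.mul (.add (.const Δ) (.var 0)) (.add (.const Δ) (.var 0)))
/-- `fsD = (Δ + ε)(a² − c·ε)`. [folklore] -/
def fsDE (Δ a c : ℚ) : ArithExpr := .mul (.add (.const Δ) (.var 0)) (.sub (.const (a ^ 2)) (.mul (.const c) (.var 0)))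
/-- `fsN = 2a²(c + b) + ε(b² − c²)`. [folklore] -/
def fsNE (a b c : ℚ) : ArithExpr := .add (.const (2 * a ^ 2 * (c + b))) (.mul (.var 0) (.const (b ^ 2 - c ^ 2)))
/-- `dcA = (Δ + ε)(Δ + 3ε)`. [folklore] -/
def dcAE (Δ : ℚ) : ArithExpr := .mul (.add (.const Δ) (.var 0)) (.add (.const Δ) (.mul (.const 3) (.var 0)))
/-- `dfsD = a² − c(Δ + 2ε)`. [folklore] -/
def dfsDE (Δ a c : ℚ) : ArithExpr := .sub (.const (a ^ 2)) (.mul (.const c) (.add (.const Δ) (.mul (.const 2) (.var 0))))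
/-- `4fsD + 16fsN`. [folklore] -/
def faceDenE (Δ a b c : ℚ) : ArithExpr := .add (.mul (.const 4) (fsDE Δ a c)) (.mul (.const 16) (fsNE a b c))
/-- `∂_ε charCubic(1, y) = dcA − 4dfsD·(1 + y) − 16dfsN·y`. [folklore] -/
def dcharFaceE (Δ a b c : ℚ) : ArithExpr :=
  .sub (.sub (dcAE Δ) (.mul (.mul (.const 4) (dfsDE Δ a c)) (.add (.const 1) (.var 1))))
    (.mul (.const (16 * (b ^ 2 - c ^ 2))) (.var 1))
/-- `(4fsD + 16fsN)²·y(1 − y)`. [folklore] -/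
def faceNumE (Δ a b c : ℚ) : ArithExpr :=
  .mul (.mul (faceDenE Δ a b c) (faceDenE Δ a b c)) (.mul (.var 1) (.sub (.const 1) (.var 1)))

/-- [folklore] -/
@[simp] theorem eval_cAE (Δ : ℚ) (e y : ℝ) : (cAE Δ).eval (pt₂ e y) = cA Δ e := by
  simp only [cAE, cA, ArithExpr.eval_mul, ArithExpr.eval_add, ArithExpr.eval_const, ArithExpr.eval_var,
    pt₂_zero]
  ring
/-- [folklore] -/
@[simp] theorem eval_fsDE (Δ a c : ℚ) (e y : ℝ) : (fsDE Δ a c).eval (pt₂ e y) = fsD Δ a c e := by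
  simp only [fsDE, fsD, ArithExpr.eval_mul, ArithExpr.eval_add, ArithExpr.eval_sub, ArithExpr.eval_const, ArithExpr.eval_var,
    pt₂_zero, Rat.cast_pow]

/-- [folklore] -/
@[simp] theorem eval_fsNE (a b c : ℚ) (e y : ℝ) : (fsNE a b c).eval (pt₂ e y) = fsN a b c e := by
  simp only [fsNE, fsN, ArithExpr.eval_mul, ArithExpr.eval_add, ArithExpr.eval_const, ArithExpr.eval_var,
    pt₂_zero, Rat.cast_pow, Rat.cast_mul, Rat.cast_add, Rat.cast_sub, Rat.cast_ofNat]

/-- [folklore] -/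
@[simp] theorem eval_dcAE (Δ : ℚ) (e y : ℝ) : (dcAE Δ).eval (pt₂ e y) = dcA Δ e := by
  simp only [dcAE, dcA, ArithExpr.eval_mul, ArithExpr.eval_add, ArithExpr.eval_const, ArithExpr.eval_var,
    pt₂_zero, Rat.cast_ofNat]

/-- [folklore] -/
@[simp] theorem eval_dfsDE (Δ a c : ℚ) (e y : ℝ) : (dfsDE Δ a c).eval (pt₂ e y) = dfsD Δ a c e := by
  simp only [dfsDE, dfsD, ArithExpr.eval_mul, ArithExpr.eval_add, ArithExpr.eval_sub, ArithExpr.eval_const, ArithExpr.eval_var,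
    pt₂_zero, Rat.cast_pow, Rat.cast_ofNat]

/-- [folklore] -/
@[simp] theorem eval_faceDenE (Δ a b c : ℚ) (e y : ℝ) :
    (faceDenE Δ a b c).eval (pt₂ e y) = 4 * fsD Δ a c e + 16 * fsN a b c e := by
  simp only [faceDenE, ArithExpr.eval_mul, ArithExpr.eval_add, ArithExpr.eval_const, eval_fsDE, eval_fsNE, Rat.cast_ofNat]
/-- [folklore] -/
@[simp] theorem eval_dcharFaceE (Δ a b c : ℚ) (e y : ℝ) :
    (dcharFaceE Δ a b c).eval (pt₂ e y) = dcharCubic Δ a b c 1 y e := by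
  simp only [dcharFaceE, dcharCubic, dfsN, eval_dcAE, eval_dfsDE, ArithExpr.eval_mul, ArithExpr.eval_add, ArithExpr.eval_sub, ArithExpr.eval_const, ArithExpr.eval_var, pt₂_one, Rat.cast_pow, Rat.cast_mul, Rat.cast_sub, Rat.cast_ofNat]

  ring
/-- [folklore] -/
@[simp] theorem eval_faceNumE (Δ a b c : ℚ) (e y : ℝ) :
    (faceNumE Δ a b c).eval (pt₂ e y) = (4 * fsD Δ a c e + 16 * fsN a b c e) ^ 2 * (y * (1 - y)) := by
  simp only [faceNumE, eval_faceDenE, ArithExpr.eval_mul, ArithExpr.eval_sub, ArithExpr.eval_const, ArithExpr.eval_var, pt₂_one]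

  ring

/-- **`faceCheck`** at a rational one-body point `(Δ, a, b, c) = (Δ_pd, t_pd, t_pp, t_pp′)` and energy bracket `[e₁, e₂]`: on the box
`[e₁, e₂] × [0, 1]` the face denominator `4fsD + 16fsN ≥ η > 0` and the LINEAR face equation forces `y ∈ [y₁, y₂]`
(`y₁·(4fsD+16fsN) ≤ cA − 4fsD ≤ y₂·(4fsD+16fsN)`); on `[e₁, e₂] × [y₁, y₂]` the energy denominator `∂_ε charCubic(1, y) ≥ η` and
`lo·(∂_ε charCubic)² ≤ (4fsD+16fsN)²·y(1−y) ≤ hi·(∂_ε charCubic)²`. Six kd certificates. [cite: Moore1966, Theorem 3.1, §4.4] -/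
def faceCheck (Δ a b c e₁ e₂ y₁ y₂ lo hi η : ℚ) (t0 t1 t2 t3 t4 t5 : KdCert ℕ) : Bool :=
  let B01 : Box := [(e₁, e₂), (0, 1)]
  let B : Box := [(e₁, e₂), (y₁, y₂)]
  let D2 : ArithExpr := .mul (dcharFaceE Δ a b c) (dcharFaceE Δ a b c)
  decide (0 < η) && decide (0 ≤ y₁) && decide (y₁ ≤ y₂) && decide (y₂ ≤ 1) && decide (e₁ ≤ e₂) &&
  t0.check (exprLeOn (.sub (.const η) (faceDenE Δ a b c)) 0) B01 &&
  t1.check (exprLeOn (.sub (.mul (.const y₁) (faceDenE Δ a b c)) (.sub (cAE Δ) (.mul (.const 4) (fsDE Δ a c)))) 0) B01 &&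
  t2.check (exprLeOn (.sub (.sub (cAE Δ) (.mul (.const 4) (fsDE Δ a c))) (.mul (.const y₂) (faceDenE Δ a b c))) 0) B01 &&
  t3.check (exprLeOn (.sub (.const η) (dcharFaceE Δ a b c)) 0) B &&
  t4.check (exprLeOn (.sub (.mul (.const lo) D2) (faceNumE Δ a b c)) 0) B &&
  t5.check (exprLeOn (.sub (faceNumE Δ a b c) (.mul (.const hi) D2)) 0) B

/-- **Soundness of `faceCheck`**: for every energy `ε ∈ [e₁, e₂]` and every zone-face contour point `(1, y)` with `y ∈ [0, 1]`,
`charCubic(1, y, ε) = 0`: the face point lies in `[y₁, y₂]`, `∂_ε charCubic(1, y) > 0` and `faceVel2 ∈ [lo, hi]`. [folklore] -/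
theorem faceVel2_mem_of_faceCheck {Δ a b c e₁ e₂ y₁ y₂ lo hi η : ℚ} {t0 t1 t2 t3 t4 t5 : KdCert ℕ}
    (h : faceCheck Δ a b c e₁ e₂ y₁ y₂ lo hi η t0 t1 t2 t3 t4 t5 = true)
    {ε : ℝ} (hε : ε ∈ Icc (e₁ : ℝ) e₂) {y : ℝ} (hy : y ∈ Icc (0 : ℝ) 1) (hP : charCubic Δ a b c 1 y ε = 0) :
    y ∈ Icc (y₁ : ℝ) y₂ ∧ 0 < dcharCubic Δ a b c 1 y ε ∧ faceVel2 Δ a b c y ε ∈ Icc (lo : ℝ) hi := by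
  simp only [faceCheck, Bool.and_eq_true, decide_eq_true_eq] at h
  obtain ⟨⟨⟨⟨⟨⟨⟨⟨⟨⟨hη, hy₁⟩, -⟩, hy₂⟩, -⟩, c0⟩, c1⟩, c2⟩, c3⟩, c4⟩, c5⟩ := h
  have hy01 : y ∈ Icc (((0 : ℚ) : ℚ) : ℝ) ((1 : ℚ) : ℝ) := by simpa using hy
  have d0 := eval_pt₂_le_of_kdCheck c0 hε hy01
  have d1 := eval_pt₂_le_of_kdCheck c1 hε hy01
  have d2 := eval_pt₂_le_of_kdCheck c2 hε hy01
  simp only [ArithExpr.eval_sub, ArithExpr.eval_mul, ArithExpr.eval_const, eval_faceDenE, eval_cAE, eval_fsDE, Rat.cast_zero,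
    Rat.cast_ofNat] at d0 d1 d2
  have hη' : (0 : ℝ) < η := by exact_mod_cast hη
  have hden : 0 < 4 * fsD (Δ : ℝ) a c ε + 16 * fsN (a : ℝ) b c ε := by linarith
  have hface := face_contour_eq hP
  have hyy : y ∈ Icc (y₁ : ℝ) y₂ := by
    constructor
    · by_contra hlt
      have hlt := not_le.1 hlt
      have : y * (4 * fsD (Δ : ℝ) a c ε + 16 * fsN (a : ℝ) b c ε) <
          (y₁ : ℝ) * (4 * fsD (Δ : ℝ) a c ε + 16 * fsN (a : ℝ) b c ε) := mul_lt_mul_of_pos_right hlt hden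
      linarith
    · by_contra hlt
      have hlt := not_le.1 hlt
      have : (y₂ : ℝ) * (4 * fsD (Δ : ℝ) a c ε + 16 * fsN (a : ℝ) b c ε) <
          y * (4 * fsD (Δ : ℝ) a c ε + 16 * fsN (a : ℝ) b c ε) := mul_lt_mul_of_pos_right hlt hden
      linarith
  have d3 := eval_pt₂_le_of_kdCheck c3 hε hyy
  have d4 := eval_pt₂_le_of_kdCheck c4 hε hyy
  have d5 := eval_pt₂_le_of_kdCheck c5 hε hyy
  simp only [ArithExpr.eval_sub, ArithExpr.eval_mul, ArithExpr.eval_const, eval_dcharFaceE, eval_faceNumE, Rat.cast_zero] at d3 d4 d5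
  have hdc : 0 < dcharCubic (Δ : ℝ) a b c 1 y ε := by linarith
  have hdc2 : 0 < dcharCubic (Δ : ℝ) a b c 1 y ε ^ 2 := by positivity
  refine ⟨hyy, hdc, ?_, ?_⟩
  · unfold faceVel2
    rw [le_div_iff₀ hdc2]
    nlinarith
  · unfold faceVel2
    rw [div_le_iff₀ hdc2]
    nlinarith

/-- **THE POINT FACE THEOREM**: a printed one-body set (rational `Δ_pd, t_pd, t_pp, t_pp′`), a filling window `[ν₁, ν₂]` with its certified
Fermi-energy bracket (`pointBracketCheck` of `EmeryFermiScalePoint`) and a passing `faceCheck` give: for every `ε` with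
`abFilling(ε) ∈ [ν₁, ν₂]` and every zone-face contour point `(1, y)`, `y ∈ [0, 1]` — the antinodal Fermi point `y = sin²(k_a/2)` lies in
`[y₁, y₂]`, `∂_ε charCubic > 0` and the squared face velocity of the energy-linearised σ band lies in `[lo, hi]`. [folklore] -/
theorem pointFace_of_checks {Δ a b c e₁ e₂ ν₁ ν₂ y₁ y₂ lo hi η : ℚ} {jout jin : List ℕ} {t0 t1 t2 t3 t4 t5 : KdCert ℕ}
    (hbr : pointBracketCheck Δ a b c e₁ e₂ ν₁ ν₂ jout jin = true)
    (hfc : faceCheck Δ a b c e₁ e₂ y₁ y₂ lo hi η t0 t1 t2 t3 t4 t5 = true)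
    {ε y : ℝ} (hν : abFilling Δ a b c ε ∈ Icc (ν₁ : ℝ) ν₂) (hy : y ∈ Icc (0 : ℝ) 1) (hP : charCubic Δ a b c 1 y ε = 0) :
    y ∈ Icc (y₁ : ℝ) y₂ ∧ 0 < dcharCubic Δ a b c 1 y ε ∧ faceVel2 Δ a b c y ε ∈ Icc (lo : ℝ) hi :=
  faceVel2_mem_of_faceCheck hfc (fermiEnergy_mem_Icc_of_pointBracketCheck hbr hν) hy hP

end Summit.Ventures.CertifiedManyBodySolver.Downfold.Emery
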